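/-
Copyright (c) 2026 the pub-hodgecm-mathlib formalisation cell (harness21).  Prover seat hodgecm-mathlib-K2Liu-p06 (g4), Track B «K2-LIT»,
#184♮ = hLiu418 = `stmt-HodgeConjecture-24832`; #42S payer road, organ S1 (local Siegel–Weil spanning), ROAD W file F2 (census
`K2/K2Liu-p06/g4/CENSUS-S1-LocalSWSpanning.K2Liu-p06-g4.md` §0 (W1), §8; director g38 «EMIT-42S» (a), LEAD F0P6-plan (g13) DESIGN-S1).
-/
import Literature.NumberTheory.K2Lit.LocalDoublingSiegel                    -- ★ `siegelDeltaLoc`, `mem_siegelDeltaLoc_iff_local`; ★ D1 `localDegPS`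
import Literature.NumberTheory.Automorphic.CongruenceSubgroupExpansionGL     -- ★ `nonarchimedeanGroup_gl`
import Literature.NumberTheory.Automorphic.SmoothIndClosedCellNonzero         -- ★ `NonarchimedeanGroup.subgroup`
import Literature.Topology.Algebra.UnitsNonarchimedean                       -- ★ `Pi.instNonarchimedeanGroup`
import Mathlib.GroupTheory.DoubleCoset
import HarnessLib

/-!
# Crux `HLiu418`, #42S organ S1, ROAD W, file F2: SECTIONS SUPPORTED IN THE BIG CELL GENERATE THE DEGENERATE PRINCIPAL SERIES
# (the GENERATION LEMMA (W1): an `H_v`-stable subspace of `I_v(s, χ_v)` containing every big-cell-supported section is all of `I_v(s, χ_v)`)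

Cell `hodgecm-mathlib`, crux item hLiu418 = `stmt-HodgeConjecture-24832`; squad K2 ∕ K2Liu; LEAD F0P6-plan (g13); prover K2Liu-p06 (g4), the dedicated
S1 hand.  THEOREMS ONLY (no `def`, no instance, no notation, no named-fact hypothesis, no `sorry`); lane `--supports stmt-HodgeConjecture-24832 --as helper`.

WHY.  Organ S1 of the #42S payer road is the local spanning `I_v(½, χ_v) = R₂(V⁺_v) + R₂(V⁻_v)` (finite `v`).  ROAD W (census §0) reduces it to ONE explicit
element through two model-free lemmas; this file is the first: **(W1) GENERATION** — for ANY `s`, ANY `χ_v`, ANY `n`, a subspace `U ≤ (H_v → ℂ)` stable under right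
translation which contains every smooth Siegel section supported in `P_Δ·C` for a compact subset `C` of the big cell `Ω = P_Δ w_Δ N_Δ` contains EVERY smooth Siegel
section.  The proof is pure topology ([BernsteinZelevinsky1976, §1, §2.2 (l-spaces, compactly supported sections)], the p-adic «partition of unity»):
Iwasawa `H_v = P_Δ·K₀` with `K₀` compact (BY VALUE, as in ★ `K2LiuLocalDegPSLevelFinite`; discharged by ★ `exists_isStd_placeAdapted` ∕ ★
`exists_isSiegelDelta_mul_mem_localInt`), the tube lemma over `K₀` for `(k, u) ↦ k u k⁻¹ w` gives an open subgroup `K'` with `k K' k⁻¹ w ⊆ Ω` for all `k ∈ K₀`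
(`H_v` is non-archimedean), `f` is cut along the finitely many (clopen) double cosets `P_Δ k K'` meeting `K₀`, and the right translate of each piece by `w⁻¹ k`
is supported in `P_Δ·C ⊆ Ω` with `C` compact — so lies in `U`.
* §1 (ANY topological group `G`, `[NonarchimedeanGroup G]` in the main lemma): plumbing on double cosets (`isOpen_doubleCoset`, `isClosed_doubleCoset`, the indicator pieces are
  sections: `indicator_doubleCoset_law`, `indicator_doubleCoset_smooth`), and the generation lemma **`mem_of_bigCell_pieces_mem`**.
* §2 (the doubled group `H_v = U(𝕍 ⊕ −𝕍)(L⁺_v)` of the K2Liu datum, `P_Δ(L⁺_v) = siegelDeltaLoc v`, ★ D1 `localDegPS`): `H_v` is non-archimedean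
  (`nonarchimedeanGroup_localPi`, via ★ `nonarchimedeanGroup_gl` and ★ `NonarchimedeanGroup.subgroup`) and **`localDegPS_le_of_bigCell_pieces_mem`** — the form ROAD W's files F3 (lattice lemma) and F7 (witness) consume.
The big cell enters only through its three properties used: OPEN, left-`P_Δ`-stable, contains `w` — taken BY VALUE (`Ω`, `w` binders), so that this file does not
depend on the block-matrix transport of ★ `K2LiuSiegelBruhatCells` (that is F3's business, where the `N_Δ`-coordinate is needed anyway).
References: [BernsteinZelevinsky1976] I. N. Bernstein, A. V. Zelevinsky, Russian Math. Surveys 31 (1976) §1.1–1.5, §2.2; [Casselman1995] §3.1, §6.1 (Bruhat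
filtration of induced representations); [HarrisKudlaSweet1996] §1 (1.15) (`I_n(s,χ)`); [KudlaSweet1997] Thm 1.2 (the spanning this road pays; NOT used).
HONEST LABEL.  Count-neutral helper: `HC_CM` is proved only modulo the 7 printed citations (2 remaining named inputs: hLiu418 = `stmt-HodgeConjecture-24832`,
h413 = `stmt-HodgeConjecture-24833`) until rung 0 closes.
-/

set_option autoImplicit false
set_option linter.dupNamespace false -- the mandated namespace repeats `HodgeConjecture.HodgeConjecture`

noncomputable section

open NumberField IsDedekindDomain
open scoped Matrix Pointwise

namespace Summit.HodgeConjecture.HodgeConjecture.Cruxes.HLiu418.K2LiuLocalSWBigCellGeneration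

open Literature.NumberTheory.Automorphic
open Literature.NumberTheory.GelbartRogawski1991 Literature.NumberTheory.GelbartRogawski1991.GRConstruction
open Literature.NumberTheory.GelbartRogawski1991.UnitaryDualPair
open Literature.NumberTheory.K2Lit.SiegelDoubled Literature.NumberTheory.K2Lit.LocalSiegelDoubled

/-! ## §1 Abstract: big-cell pieces generate -/

section Abstract

variable {G : Type*} [Group G] [TopologicalSpace G]

/-- a double coset `P t K'` with `K'` OPEN is open. [cite: BernsteinZelevinsky1976, §1.1] -/
theorem isOpen_doubleCoset [IsTopologicalGroup G] (P K' : Subgroup G) (hK' : IsOpen (K' : Set G)) (t : G) :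
    IsOpen (DoubleCoset.doubleCoset t (P : Set G) K') := by
  rw [DoubleCoset.doubleCoset]
  exact hK'.mul_left

/-- a double coset `P t K'` with `K'` open is CLOSED (its complement is a union of open double cosets). [cite: BernsteinZelevinsky1976, §1.1] -/
theorem isClosed_doubleCoset [IsTopologicalGroup G] (P K' : Subgroup G) (hK' : IsOpen (K' : Set G)) (t : G) :
    IsClosed (DoubleCoset.doubleCoset t (P : Set G) K') := by
  rw [← isOpen_compl_iff, isOpen_iff_forall_mem_open]
  intro x hx
  refine ⟨DoubleCoset.doubleCoset x (P : Set G) K', fun y hy hyt => ?_, isOpen_doubleCoset P K' hK' x,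
    DoubleCoset.mem_doubleCoset_self P K' x⟩
  have hne : ¬Disjoint (DoubleCoset.doubleCoset t (P : Set G) K') (DoubleCoset.doubleCoset x (P : Set G) K') :=
    Set.not_disjoint_iff.2 ⟨y, hyt, hy⟩
  exact hx (DoubleCoset.eq_of_not_disjoint hne ▸ DoubleCoset.mem_doubleCoset_self P K' x)

omit [TopologicalSpace G] in
/-- double cosets are left-`P`-stable: `p x ∈ P t K' ↔ x ∈ P t K'`. [cite: BernsteinZelevinsky1976, §1.1] -/
theorem mul_mem_doubleCoset_iff (P K' : Subgroup G) (t : G) {p : G} (hp : p ∈ P) (x : G) :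
    p * x ∈ DoubleCoset.doubleCoset t (P : Set G) K' ↔ x ∈ DoubleCoset.doubleCoset t (P : Set G) K' := by
  constructor
  · intro h
    obtain ⟨q, hq, u, hu, hqu⟩ := DoubleCoset.mem_doubleCoset.1 h
    refine DoubleCoset.mem_doubleCoset.2 ⟨p⁻¹ * q, P.mul_mem (P.inv_mem hp) hq, u, hu, ?_⟩
    rw [mul_assoc, mul_assoc, ← mul_assoc q, ← hqu, ← mul_assoc, inv_mul_cancel, one_mul]
  · intro h
    obtain ⟨q, hq, u, hu, hqu⟩ := DoubleCoset.mem_doubleCoset.1 h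
    exact DoubleCoset.mem_doubleCoset.2 ⟨p * q, P.mul_mem hp hq, u, hu, by rw [hqu, mul_assoc, mul_assoc, mul_assoc]⟩

omit [TopologicalSpace G] in
/-- double cosets are right-`K'`-stable: `x u ∈ P t K' ↔ x ∈ P t K'`. [cite: BernsteinZelevinsky1976, §1.1] -/
theorem mul_mem_doubleCoset_iff_right (P K' : Subgroup G) (t : G) (x : G) {u : G} (hu : u ∈ K') :
    x * u ∈ DoubleCoset.doubleCoset t (P : Set G) K' ↔ x ∈ DoubleCoset.doubleCoset t (P : Set G) K' := by
  constructor
  · intro h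
    obtain ⟨q, hq, u', hu', hqu⟩ := DoubleCoset.mem_doubleCoset.1 h
    refine DoubleCoset.mem_doubleCoset.2 ⟨q, hq, u' * u⁻¹, K'.mul_mem hu' (K'.inv_mem hu), ?_⟩
    rw [← mul_assoc, ← hqu, mul_assoc, mul_inv_cancel, mul_one]
  · intro h
    obtain ⟨q, hq, u', hu', hqu⟩ := DoubleCoset.mem_doubleCoset.1 h
    exact DoubleCoset.mem_doubleCoset.2 ⟨q, hq, u' * u, K'.mul_mem hu' hu, by rw [hqu, mul_assoc]⟩

omit [TopologicalSpace G] in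
/-- the piece `1_{P t K'} · f` of a section is a section (left law). [cite: BernsteinZelevinsky1976, §2.2] -/
theorem indicator_doubleCoset_law (P K' : Subgroup G) (t : G) {χ : G → ℂ} {f : G → ℂ}
    (hf : ∀ p ∈ P, ∀ h, f (p * h) = χ p * f h) (p : G) (hp : p ∈ P) (h : G) :
    (DoubleCoset.doubleCoset t (P : Set G) K').indicator f (p * h) = χ p * (DoubleCoset.doubleCoset t (P : Set G) K').indicator f h := by
  by_cases hh : h ∈ DoubleCoset.doubleCoset t (P : Set G) K'
  · rw [Set.indicator_of_mem hh, Set.indicator_of_mem ((mul_mem_doubleCoset_iff P K' t hp h).2 hh), hf p hp h]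
  · rw [Set.indicator_of_notMem hh, Set.indicator_of_notMem (fun h' => hh ((mul_mem_doubleCoset_iff P K' t hp h).1 h')), mul_zero]

omit [TopologicalSpace G] in
/-- the piece `1_{P t K'} · f` is right-`K'`-invariant when `f` is. [cite: BernsteinZelevinsky1976, §2.2] -/
theorem indicator_doubleCoset_smooth (P K' : Subgroup G) (t : G) {f : G → ℂ} (hf : ∀ h, ∀ u ∈ K', f (h * u) = f h)
    (h u : G) (hu : u ∈ K') :
    (DoubleCoset.doubleCoset t (P : Set G) K').indicator f (h * u) = (DoubleCoset.doubleCoset t (P : Set G) K').indicator f h := by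
  by_cases hh : h ∈ DoubleCoset.doubleCoset t (P : Set G) K'
  · rw [Set.indicator_of_mem hh, Set.indicator_of_mem ((mul_mem_doubleCoset_iff_right P K' t h hu).2 hh), hf h u hu]
  · rw [Set.indicator_of_notMem hh, Set.indicator_of_notMem (fun h' => hh ((mul_mem_doubleCoset_iff_right P K' t h hu).1 h'))]

omit [TopologicalSpace G] in
/-- right translation preserves the left law. [cite: BernsteinZelevinsky1976, §2.2] -/
theorem law_translate {P : Subgroup G} {χ : G → ℂ} {f : G → ℂ} (hf : ∀ p ∈ P, ∀ h, f (p * h) = χ p * f h) (g : G) :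
    ∀ p ∈ P, ∀ h, (fun x => f (x * g)) (p * h) = χ p * (fun x => f (x * g)) h := by
  intro p hp h
  simp only [mul_assoc]
  exact hf p hp (h * g)

/-- right translation by `g` carries a right-`K'`-invariant function to a right-`gK'g⁻¹`-invariant one; `gK'g⁻¹` is open. [cite: BernsteinZelevinsky1976, §2.2] -/
theorem smooth_translate [IsTopologicalGroup G] {K' : Subgroup G} (hK' : IsOpen (K' : Set G)) {f : G → ℂ} (hf : ∀ h, ∀ u ∈ K', f (h * u) = f h) (g : G) :
    ∃ V : Subgroup G, IsOpen (V : Set G) ∧ ∀ h, ∀ u ∈ V, (fun x => f (x * g)) (h * u) = (fun x => f (x * g)) h := by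
  refine ⟨K'.comap (MulAut.conj g⁻¹).toMonoidHom, ?_, fun h u hu => ?_⟩
  · change IsOpen ((fun x : G => g⁻¹ * x * g⁻¹⁻¹) ⁻¹' (K' : Set G))
    exact hK'.preimage (by fun_prop)
  · have hu' : g⁻¹ * u * g ∈ K' := by simpa [MulAut.conj_apply] using hu
    have : h * u * g = h * g * (g⁻¹ * u * g) := by group
    simp only [this, hf (h * g) _ hu']

/-- **THE GENERATION LEMMA (W1).**  `G` a non-archimedean topological group, `P ≤ G`, `χ : G → ℂ`, `K₀ ⊆ G` COMPACT with `G = P·K₀` (Iwasawa BY VALUE), `Ω ⊆ G`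
OPEN, left-`P`-stable, containing `w`.  Let `U ≤ (G → ℂ)` be a subspace stable under right translations which contains every function `F` that (i) obeys the
left law `F (p h) = χ p · F h`, (ii) is right-invariant under an open subgroup, and (iii) is supported in `P·C` for some COMPACT `C ⊆ Ω`.  Then `U` contains
EVERY function with (i) and (ii).  (Big-cell-supported smooth sections generate the induced representation as a `G`-module.)
[cite: BernsteinZelevinsky1976, §1.5, §2.2 (compactly supported sections, partition along clopen double cosets)] [cite: Casselman1995, §6.1] -/
theorem mem_of_bigCell_pieces_mem [NonarchimedeanGroup G]
    {P : Subgroup G} {χ : G → ℂ} {K₀ : Set G} (hK₀ : IsCompact K₀) (hIw : ∀ g : G, ∃ p ∈ P, ∃ k ∈ K₀, g = p * k)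
    {Ω : Set G} (hΩ : IsOpen Ω) (hPΩ : ∀ p ∈ P, ∀ x ∈ Ω, p * x ∈ Ω) {w : G} (hw : w ∈ Ω)
    (U : Submodule ℂ (G → ℂ)) (hU : ∀ F ∈ U, ∀ g : G, (fun h => F (h * g)) ∈ U)
    (hUΩ : ∀ F : G → ℂ, (∀ p ∈ P, ∀ h, F (p * h) = χ p * F h) →
      (∃ V : Subgroup G, IsOpen (V : Set G) ∧ ∀ h, ∀ u ∈ V, F (h * u) = F h) →
      (∃ C : Set G, IsCompact C ∧ C ⊆ Ω ∧ ∀ h, F h ≠ 0 → ∃ p ∈ P, ∃ c ∈ C, h = p * c) → F ∈ U)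
    (f : G → ℂ) (hf : ∀ p ∈ P, ∀ h, f (p * h) = χ p * f h)
    (hfs : ∃ V : Subgroup G, IsOpen (V : Set G) ∧ ∀ h, ∀ u ∈ V, f (h * u) = f h) :
    f ∈ U := by
  classical
  obtain ⟨V, hVo, hV⟩ := hfs
  -- tube lemma over `K₀` for `(k, u) ↦ k u k⁻¹ w`
  set S : Set (G × G) := {q | q.1 * q.2 * q.1⁻¹ * w ∈ Ω} with hS_def
  have hS : IsOpen S := hΩ.preimage (by fun_prop)
  have hKS : K₀ ×ˢ ({1} : Set G) ⊆ S := by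
    rintro ⟨k, x⟩ ⟨-, hx⟩
    rw [Set.mem_singleton_iff] at hx
    subst hx
    show k * 1 * k⁻¹ * w ∈ Ω
    simpa using hw
  obtain ⟨u₁, v₁, hu₁, hv₁, hK₀u₁, h1v₁, huv⟩ := generalized_tube_lemma hK₀ isCompact_singleton hS hKS
  have h1v : (1 : G) ∈ v₁ := h1v₁ rfl
  -- an open subgroup `K' ⊆ v₁ ∩ V`
  obtain ⟨K', hK'⟩ := NonarchimedeanGroup.is_nonarchimedean (v₁ ∩ (V : Set G))
    (Filter.inter_mem (hv₁.mem_nhds h1v) (hVo.mem_nhds V.one_mem))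
  have hK'o : IsOpen ((K' : Subgroup G) : Set G) := K'.isOpen
  have hK'v : ∀ u ∈ (K' : Subgroup G), u ∈ v₁ := fun u hu => (hK' hu).1
  have hK'V : ∀ u ∈ (K' : Subgroup G), u ∈ V := fun u hu => (hK' hu).2
  have hfK' : ∀ h, ∀ u ∈ (K' : Subgroup G), f (h * u) = f h := fun h u hu => hV h u (hK'V u hu)
  -- the key inclusion: `k u k⁻¹ w ∈ Ω` for `k ∈ K₀`, `u ∈ K'`
  have hkey : ∀ k ∈ K₀, ∀ u ∈ (K' : Subgroup G), k * u * k⁻¹ * w ∈ Ω := fun k hk u hu =>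
    huv (Set.mk_mem_prod (hK₀u₁ hk) (hK'v u hu))
  -- finite cover of `K₀` by cosets `k K'`
  have hcov : K₀ ⊆ ⋃ k ∈ K₀, (fun x => k * x) '' ((K' : Subgroup G) : Set G) := fun k hk =>
    Set.mem_biUnion hk ⟨1, K'.one_mem, mul_one k⟩
  obtain ⟨T, hTK₀, hTfin, hTcov⟩ := hK₀.elim_finite_subcover_image
    (fun k _ => (Homeomorph.mulLeft k).isOpenMap _ hK'o) hcov
  -- the finitely many double cosets meeting `K₀`
  set 𝒟 : Finset (Set G) := hTfin.toFinset.image fun t => DoubleCoset.doubleCoset t (P : Set G) (K' : Subgroup G) with h𝒟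
  -- every point lies in one of them
  have hmem𝒟 : ∀ h : G, ∃ D ∈ 𝒟, h ∈ D := by
    intro h
    obtain ⟨p, hp, k, hk, rfl⟩ := hIw h
    obtain ⟨t, ht, x, hx, hkx⟩ : ∃ t ∈ T, ∃ x ∈ ((K' : Subgroup G) : Set G), k = t * x := by
      have := hTcov hk
      simp only [Set.mem_iUnion, Set.mem_image] at this
      obtain ⟨t, ht, x, hx, hxk⟩ := this
      exact ⟨t, ht, x, hx, hxk.symm⟩
    refine ⟨DoubleCoset.doubleCoset t (P : Set G) (K' : Subgroup G), Finset.mem_image.2 ⟨t, hTfin.mem_toFinset.2 ht, rfl⟩, ?_⟩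
    exact DoubleCoset.mem_doubleCoset.2 ⟨p, hp, x, hx, by rw [hkx, mul_assoc]⟩
  -- `f` is the sum of its pieces
  have hsum : f = ∑ D ∈ 𝒟, D.indicator f := by
    funext h
    obtain ⟨D₀, hD₀, hhD₀⟩ := hmem𝒟 h
    rw [Finset.sum_apply, Finset.sum_eq_single_of_mem D₀ hD₀, Set.indicator_of_mem hhD₀]
    intro D hD hne
    apply Set.indicator_of_notMem
    intro hhD
    obtain ⟨t, -, rfl⟩ := Finset.mem_image.1 hD
    obtain ⟨t₀, -, rfl⟩ := Finset.mem_image.1 hD₀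
    exact hne (DoubleCoset.eq_of_not_disjoint (Set.not_disjoint_iff.2 ⟨h, hhD, hhD₀⟩))
  rw [hsum]
  refine Submodule.sum_mem U fun D hD => ?_
  obtain ⟨t, ht, rfl⟩ := Finset.mem_image.1 hD
  have htK₀ : t ∈ K₀ := hTK₀ (hTfin.mem_toFinset.1 ht)
  -- the piece, translated by `g := w⁻¹ t`, is supported in `P·C`, `C` compact inside `Ω`
  set D := DoubleCoset.doubleCoset t (P : Set G) (K' : Subgroup G) with hD_def
  set g : G := w⁻¹ * t with hg
  have hDc : IsCompact (K₀ ∩ D) := hK₀.inter_right (isClosed_doubleCoset P K' hK'o t)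
  have hFU : (fun h => D.indicator f (h * g)) ∈ U := by
    refine hUΩ _ (law_translate (indicator_doubleCoset_law P K' t hf) g)
      (smooth_translate hK'o (indicator_doubleCoset_smooth P K' t hfK') g) ?_
    refine ⟨(fun k => k * g⁻¹) '' (K₀ ∩ D), hDc.image (continuous_id.mul continuous_const), ?_, ?_⟩
    · rintro _ ⟨k, ⟨hk, hkD⟩, rfl⟩
      obtain ⟨p, hp, u, hu, rfl⟩ := DoubleCoset.mem_doubleCoset.1 hkD
      have : p * t * u * g⁻¹ = p * (t * u * t⁻¹ * w) := by rw [hg]; group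
      show p * t * u * g⁻¹ ∈ Ω
      rw [this]
      exact hPΩ p hp _ (hkey t htK₀ u hu)
    · intro h hh
      have hhD : h * g ∈ D := by
        by_contra hc
        exact hh (Set.indicator_of_notMem hc f)
      obtain ⟨p, hp, k, hk, hpk⟩ := hIw (h * g)
      have hkD : k ∈ D := by
        have : k = p⁻¹ * (h * g) := by rw [hpk, ← mul_assoc, inv_mul_cancel, one_mul]
        rw [this]
        exact (mul_mem_doubleCoset_iff P K' t (P.inv_mem hp) _).2 hhD
      refine ⟨p, hp, k * g⁻¹, ⟨k, ⟨hk, hkD⟩, rfl⟩, ?_⟩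
      rw [← mul_assoc, ← hpk, mul_assoc, mul_inv_cancel, mul_one]
  have := hU _ hFU g⁻¹
  simp only [mul_assoc, inv_mul_cancel, mul_one] at this
  -- `this : (fun h => D.indicator f (h * (g⁻¹ * g)))`-reduced form
  convert this using 1

end Abstract

/-! ## §2 The doubled group at a finite place -/

variable (L : Type) [Field L] [NumberField L] [IsCMField L]
variable {N M n : ℕ} (e : Fin N × Fin M ≃ Fin n)
  (dV : Fin N → L) (hdV : ∀ i, IsCMField.complexConj L (dV i) = dV i)
  (dW : Fin M → L) (hdW : ∀ i, IsCMField.complexConj L (dW i) = dW i)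
variable (v : HeightOneSpectrum (𝓞 (Fp L)))

omit [IsCMField L] in
/-- **`H_v = U(𝔻)(L⁺_v)` is a non-archimedean group**: a subgroup of `Π_{w ∣ v} GL_{2n}(L_w)`, each factor non-archimedean (★ `nonarchimedeanGroup_gl`).
[cite: PlatonovRapinchuk1994, §3.3] [cite: BernsteinZelevinsky1976, §1.1] -/
theorem nonarchimedeanGroup_localPi (c : L ≃ₐ[Fp L] L) (J : Matrix (Fin (n + n)) (Fin (n + n)) L) :
    NonarchimedeanGroup (UnitaryGroup.localPi L c (n + n) J v) := by
  haveI : ∀ w : UnitaryGroup.PlacesOver L v, NonarchimedeanGroup (GL (Fin (n + n)) (w.1.adicCompletion L)) :=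
    fun w => nonarchimedeanGroup_gl (w.1.adicCompletion L) (n + n)
  exact NonarchimedeanGroup.subgroup _

set_option maxHeartbeats 1600000 in -- statement elaboration of the ★ D1 telescope `localDegPS (Fp L) L …` (as in ★ #7b `K2LiuSiegelWeilSectionMem`)
/-- **(W1) FOR `I_v(s, χ_v)`: BIG-CELL PIECES GENERATE.**  At a finite place `v` of `L⁺`, let `K₀ ⊆ H_v` be compact with `H_v = P_Δ(L⁺_v)·K₀` (Iwasawa BY VALUE),
`Ω ⊆ H_v` open, left-`P_Δ`-stable, `w ∈ Ω` (the big cell `P_Δ w_Δ N_Δ` and `w_Δ`, BY VALUE).  If `U ≤ (H_v → ℂ)` is stable under right translations and contains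
every element of ★ `localDegPS χ_v s` supported in `P_Δ·C` for some compact `C ⊆ Ω`, then `localDegPS χ_v s ≤ U`.
[cite: BernsteinZelevinsky1976, §2.2] [cite: Casselman1995, §6.1] [cite: HarrisKudlaSweet1996, §1 (1.15)] -/
theorem localDegPS_le_of_bigCell_pieces_mem
    (χv : ∀ w : UnitaryGroup.PlacesOver L v, (w.1.adicCompletion L)ˣ →* ℂˣ) (s : ℂ)
    {K₀ : Set (UnitaryGroup.localPi L (IsCMField.complexConj L) (n + n) (hermD L e dV hdV dW hdW) v)} (hK₀ : IsCompact K₀)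
    (hIw : ∀ g : UnitaryGroup.localPi L (IsCMField.complexConj L) (n + n) (hermD L e dV hdV dW hdW) v,
      ∃ p ∈ siegelDeltaLoc L e dV hdV dW hdW v, ∃ k ∈ K₀, g = p * k)
    {Ω : Set (UnitaryGroup.localPi L (IsCMField.complexConj L) (n + n) (hermD L e dV hdV dW hdW) v)} (hΩ : IsOpen Ω)
    (hPΩ : ∀ p ∈ siegelDeltaLoc L e dV hdV dW hdW v, ∀ x ∈ Ω, p * x ∈ Ω)
    {w : UnitaryGroup.localPi L (IsCMField.complexConj L) (n + n) (hermD L e dV hdV dW hdW) v} (hw : w ∈ Ω)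
    (U : Submodule ℂ (UnitaryGroup.localPi L (IsCMField.complexConj L) (n + n) (hermD L e dV hdV dW hdW) v → ℂ))
    (hU : ∀ F ∈ U, ∀ g, (fun h => F (h * g)) ∈ U)
    (hUΩ : haveI : Algebra.IsQuadraticExtension (Fp L) L := IsCMField.isQuadraticExtension L
      ∀ F ∈ localDegPS (Fp L) L (IsCMField.complexConj L) (complexConj_imagUnit L) (imagUnit_ne_zero L) (imagUnit_mul_self L)
          v n (gramR_isSymm L e dV hdV dW hdW) (hermD_eq_map_gramD L e dV hdV dW hdW) χv s,
        (∃ C, IsCompact C ∧ C ⊆ Ω ∧ ∀ h, F h ≠ 0 → ∃ p ∈ siegelDeltaLoc L e dV hdV dW hdW v, ∃ c ∈ C, h = p * c) → F ∈ U) :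
    haveI : Algebra.IsQuadraticExtension (Fp L) L := IsCMField.isQuadraticExtension L
    localDegPS (Fp L) L (IsCMField.complexConj L) (complexConj_imagUnit L) (imagUnit_ne_zero L) (imagUnit_mul_self L)
        v n (gramR_isSymm L e dV hdV dW hdW) (hermD_eq_map_gramD L e dV hdV dW hdW) χv s ≤ U := by
  haveI : Algebra.IsQuadraticExtension (Fp L) L := IsCMField.isQuadraticExtension L
  haveI := nonarchimedeanGroup_localPi L v (IsCMField.complexConj L) (hermD L e dV hdV dW hdW)
  intro f hf
  -- the character of the left law, read on the subgroup `siegelDeltaLoc v`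
  set χ : UnitaryGroup.localPi L (IsCMField.complexConj L) (n + n) (hermD L e dV hdV dW hdW) v → ℂ :=
    localSiegelCharacter (Fp L) L (IsCMField.complexConj L) v n χv s with hχ
  have hlaw : ∀ F : UnitaryGroup.localPi L (IsCMField.complexConj L) (n + n) (hermD L e dV hdV dW hdW) v → ℂ,
      IsLocalSiegelSection (Fp L) L (IsCMField.complexConj L) (complexConj_imagUnit L) (imagUnit_ne_zero L) (imagUnit_mul_self L)
          v n (gramR_isSymm L e dV hdV dW hdW) (hermD_eq_map_gramD L e dV hdV dW hdW) χv s F ↔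
        ∀ p ∈ siegelDeltaLoc L e dV hdV dW hdW v, ∀ h, F (p * h) = χ p * F h := by
    intro F
    constructor
    · intro hF p hp h
      exact hF p ((mem_siegelDeltaLoc_iff_local L e dV hdV dW hdW v p).1 hp) h
    · intro hF p hp h
      exact hF p ((mem_siegelDeltaLoc_iff_local L e dV hdV dW hdW v p).2 hp) h
  have hsm : ∀ F : UnitaryGroup.localPi L (IsCMField.complexConj L) (n + n) (hermD L e dV hdV dW hdW) v → ℂ,
      IsSmooth (Fp L) L (IsCMField.complexConj L) v n F ↔
        ∃ V : Subgroup (UnitaryGroup.localPi L (IsCMField.complexConj L) (n + n) (hermD L e dV hdV dW hdW) v),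
          IsOpen (V : Set (UnitaryGroup.localPi L (IsCMField.complexConj L) (n + n) (hermD L e dV hdV dW hdW) v)) ∧
            ∀ h, ∀ u ∈ V, F (h * u) = F h := by
    intro F
    constructor
    · rintro ⟨V, hV⟩
      exact ⟨V, V.isOpen, fun h u hu => hV h u hu⟩
    · rintro ⟨V, hVo, hV⟩
      exact ⟨{ toSubgroup := V, isOpen' := hVo }, fun h u hu => hV h u hu⟩
  obtain ⟨hf1, hf2⟩ := (mem_localDegPS_iff (Fp L) L (IsCMField.complexConj L) (complexConj_imagUnit L) (imagUnit_ne_zero L)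
    (imagUnit_mul_self L) v n (gramR_isSymm L e dV hdV dW hdW) (hermD_eq_map_gramD L e dV hdV dW hdW) χv s f).1 hf
  refine mem_of_bigCell_pieces_mem (P := siegelDeltaLoc L e dV hdV dW hdW v) (χ := χ) hK₀ hIw hΩ hPΩ hw U hU ?_ f
    ((hlaw f).1 hf1) ((hsm f).1 hf2)
  intro F hF1 hF2 hF3
  exact hUΩ F ((mem_localDegPS_iff (Fp L) L (IsCMField.complexConj L) (complexConj_imagUnit L) (imagUnit_ne_zero L)
    (imagUnit_mul_self L) v n (gramR_isSymm L e dV hdV dW hdW) (hermD_eq_map_gramD L e dV hdV dW hdW) χv s F).2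
      ⟨(hlaw F).2 hF1, (hsm F).2 hF2⟩) hF3

end Summit.HodgeConjecture.HodgeConjecture.Cruxes.HLiu418.K2LiuLocalSWBigCellGeneration

end
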